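import Literature.NumberTheory.LFunctions.VanDerCorputZeta
import Literature.NumberTheory.LFunctions.ZetaTruncationUniformGap
import Literature.NumberTheory.LFunctions.ApproxFunctionalEquationGapMaster
import HarnessLib

/-!
# The sharp eta vector at the zeros — engine I: blocks of `∑ n^{-s}` and the truncation error
# off resonance (route EtaLeadingQuarter, item `EtaLeadingSecondMoment`, stmt-RiemannHypothesis-21791)

RH-free estimates on the critical line `s = 1/2 + it`, `t > 0`, for an integer length `X` and
`y = t/(2πX)`; the TRUNCATION ERROR of the approximate functional equation is
`Q_X(s) = ζ(s) − ∑_{n≤X} n^{−s} + X^{1−s}/(1−s) − afeCoeff(s) ∑_{ν ≤ [y]} ν^{s−1}`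
(the shape consumed by `SecondMomentAFE.norm_altSum_le_of_zero`).

* `norm_sum_Ioc_e_phase_le`, `norm_sum_Ioc_cpow_le` — a block `∑_{N<n≤x} n^{−s}` with `x ≤ 2N`:
  `‖·‖ ≤ (N+1)^{−1/2} · 12 (4(x−N)√λ + λ^{−1/2})`, `λ = (t/2π)/(2N)²` (van der Corput's second
  derivative test, tree `VdC.secondDerivTest`, and Abel summation `VdC.abel_bound_rpow`);
* `norm_cpow_one_sub_div_le` — `‖X^{1−s}/(1−s)‖ ≤ √X/t`;
* `norm_Q_le_of_low` — `y ≤ 1 − δ`: `‖Q_X‖ ≤ (3 + 2/δ)/√X` (tree (4.11.1) with a uniform gap);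
* `norm_Q_le_of_gap` — `y ≥ 1`, `δ ≤ {y} ≤ 1 − δ`: `‖Q_X‖ ≤ (14 + 2/δ + 4 log(y+2))/√X`
  (tree Theorem 4.13 with a gap, `AFE.approxFunctionalEq_half_of_gap`).

Nothing here bears on the truth of RH.
-/

noncomputable section

open Real Finset Complex

set_option linter.dupNamespace false  -- the mandated namespace repeats `RiemannHypothesis`

namespace Summit.RiemannHypothesis.RiemannHypothesis.Theorems.EtaLeadingQuarter.Engine

open Literature.NumberTheory.LFunctions Literature.NumberTheory.LFunctions.VdC
  Literature.NumberTheory.LFunctions.AFE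

/-! ## Blocks of `∑ n^{-1/2-it}` by the second derivative test -/

/-- **Partial sums of `n^{-it}` on `(N, y] ⊆ (N, 2N]`**:
`‖∑_{N<n≤y} n^{−it}‖ ≤ 12 (4 (y − N) √λ + λ^{−1/2})`, `λ = (t/2π)/(2N)²`. [folklore] -/
theorem norm_sum_Ioc_e_phase_le {t : ℝ} (ht : 0 < t) {N y : ℕ} (hN : 1 ≤ N) (hNy : N ≤ y)
    (hy2 : y ≤ 2 * N) :
    ‖∑ n ∈ Finset.Ioc N y, e (phaseD t 0 n)‖ ≤
      12 * (4 * ((y : ℝ) - N) * Real.sqrt (t / (2 * π) / (2 * N) ^ 2) +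
        1 / Real.sqrt (t / (2 * π) / (2 * N) ^ 2)) := by
  have hN0 : (0 : ℝ) < N := by exact_mod_cast hN
  set lam : ℝ := t / (2 * π) / (2 * N) ^ 2 with hlam
  have hlam0 : 0 < lam := by positivity
  have hD := phaseD_derivFamily t (a := (N : ℝ)) (b := (y : ℝ)) hN0 2
  have hab : ((N : ℕ) : ℤ) ≤ ((y : ℕ) : ℤ) := by exact_mod_cast hNy
  have hIcc : ∀ z : ℝ, z ∈ Set.Icc (((N : ℕ) : ℤ) : ℝ) (((y : ℕ) : ℤ) : ℝ) → z ∈ Set.Icc (N : ℝ) y := by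
    intro z hz; simpa using hz
  have h := secondDerivTest (f := phaseD t 0) (f' := phaseD t 1) (f'' := phaseD t 2)
    (a := ((N : ℕ) : ℤ)) (b := ((y : ℕ) : ℤ)) (lam := lam) (h := 4) hab hlam0 (by norm_num)
    (fun z hz ↦ hD 0 (by norm_num) z (hIcc z hz)) (fun z hz ↦ hD 1 (by norm_num) z (hIcc z hz)) ?_
  · rw [sum_Ioc_int_eq_nat] at h
    have e1 : ∑ n ∈ Finset.Ioc N y, e (phaseD t 0 ((n : ℤ) : ℝ)) =
        ∑ n ∈ Finset.Ioc N y, e (phaseD t 0 n) :=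
      Finset.sum_congr rfl fun n _ ↦ by rw [Int.cast_natCast]
    rw [e1] at h
    refine h.trans (le_of_eq ?_)
    push_cast
    ring
  · intro z hz
    have hz' := hIcc z hz
    have hz2 : z ∈ Set.Icc (N : ℝ) (2 * N) :=
      ⟨hz'.1, hz'.2.trans (by exact_mod_cast hy2)⟩
    have hb := phaseD_bound t ht hN0 1 hz2
    rw [show ((-1 : ℝ)) ^ (1 + 1) * phaseD t (1 + 1) z = phaseD t 2 z by norm_num,
      Nat.factorial_one, Nat.cast_one, mul_one] at hb
    refine ⟨hb.1, hb.2.trans (le_of_eq ?_)⟩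
    rw [hlam]; ring

/-- **A block of `∑ n^{-s}` on the critical line** (`s = 1/2 + it`, `t > 0`, `1 ≤ N ≤ x ≤ 2N`):
`‖∑_{N<n≤x} n^{−s}‖ ≤ (N+1)^{−1/2} · 12 (4 (x − N) √λ + λ^{−1/2})`, `λ = (t/2π)/(2N)²`
(van der Corput's second derivative test + Abel summation). [folklore] -/
theorem norm_sum_Ioc_cpow_le {t : ℝ} (ht : 0 < t) {N x : ℕ} (hN : 1 ≤ N) (hNx : N ≤ x)
    (hx2 : x ≤ 2 * N) :
    ‖∑ n ∈ Finset.Ioc N x, (n : ℂ) ^ (-((1 / 2 : ℂ) + t * I))‖ ≤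
      ((N : ℝ) + 1) ^ (-(1 / 2 : ℝ)) * (12 * (4 * ((x : ℝ) - N) * Real.sqrt (t / (2 * π) / (2 * N) ^ 2) +
        1 / Real.sqrt (t / (2 * π) / (2 * N) ^ 2))) := by
  have hNx' : (N : ℝ) ≤ x := by exact_mod_cast hNx
  have hB : 0 ≤ 12 * (4 * ((x : ℝ) - N) * Real.sqrt (t / (2 * π) / (2 * N) ^ 2) +
      1 / Real.sqrt (t / (2 * π) / (2 * N) ^ 2)) := by
    have : 0 ≤ (x : ℝ) - N := by linarith
    positivity
  have key := abel_bound_rpow (fun n ↦ e (phaseD t 0 n)) hNx (σ := 1 / 2) (by norm_num) hB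
    (fun y hy1 hy2 ↦ (norm_sum_Ioc_e_phase_le ht hN hy1.le (hy2.trans hx2)).trans (by
      have : (y : ℝ) ≤ x := by exact_mod_cast hy2
      gcongr))
  have e1 : ∀ n ∈ Finset.Ioc N x, (n : ℂ) ^ (-((1 / 2 : ℂ) + t * I)) =
      (((n : ℝ) ^ (-(1 / 2 : ℝ)) : ℝ) : ℂ) * e (phaseD t 0 n) := by
    intro n hn
    have hn0 : 0 < n := by rw [Finset.mem_Ioc] at hn; omega
    have h := natCast_cpow_neg_eq (1 / 2) t hn0
    rw [show (((1 / 2 : ℝ)) : ℂ) = 1 / 2 by push_cast; ring] at h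
    exact h
  rw [Finset.sum_congr rfl e1]
  exact key

/-! ## The main term `X^{1-s}/(1-s)` -/

/-- `‖X^{1−s}/(1−s)‖ ≤ √X / t` for `s = 1/2 + it`, `t > 0`, `X ≥ 1`. [folklore] -/
theorem norm_cpow_one_sub_div_le {t : ℝ} (ht : 0 < t) {X : ℕ} (hX : 1 ≤ X) (s : ℂ)
    (hs : s = 1 / 2 + t * I) :
    ‖(X : ℂ) ^ (1 - s) / (1 - s)‖ ≤ Real.sqrt X / t := by
  have hX0 : 0 < X := by omega
  have hre : (1 - s).re = 1 / 2 := by rw [hs]; simp; norm_num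
  have him : (1 - s).im = -t := by rw [hs]; simp
  have hnum : ‖(X : ℂ) ^ (1 - s)‖ = Real.sqrt X := by
    rw [Complex.norm_natCast_cpow_of_pos hX0, hre, Real.sqrt_eq_rpow]
  have hden : t ≤ ‖1 - s‖ := by
    have h := Complex.abs_im_le_norm (1 - s)
    rw [him, abs_neg, abs_of_pos ht] at h
    exact h
  rw [norm_div, hnum]
  exact div_le_div_of_nonneg_left (Real.sqrt_nonneg _) ht hden

/-! ## The truncation error off resonance -/

/-- **Below the first stationary point** (`y = t/(2πX) ≤ 1 − δ`, `0 < δ ≤ 1`): the dual sum is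
empty and `‖Q_X(s)‖ = ‖ζ(s) − ζ_X(s) + X^{1−s}/(1−s)‖ ≤ (3 + 2/δ)/√X` (Titchmarsh (4.11.1) with
a uniform gap, tree `norm_zeta_sub_sum_add_le_uniform_of_gap`). [folklore] -/
theorem norm_Q_le_of_low {t δ : ℝ} (ht : 0 < t) {X : ℕ} (hX : 1 ≤ X) (hδ : 0 < δ) (hδ1 : δ ≤ 1)
    (hy : t / (2 * π * X) ≤ 1 - δ) (s : ℂ) (hs : s = 1 / 2 + t * I) :
    ‖riemannZeta s - ∑ n ∈ Finset.Icc 1 X, (n : ℂ) ^ (-s) + (X : ℂ) ^ (1 - s) / (1 - s)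
        - afeCoeff s * ∑ n ∈ Finset.Icc 1 ⌊t / (2 * π * X)⌋₊, (n : ℂ) ^ (s - 1)‖ ≤
      (3 + 2 / δ) / Real.sqrt X := by
  have hX0 : (0 : ℝ) < X := by exact_mod_cast hX
  have hre : s.re = 1 / 2 := by rw [hs]; simp
  have him : s.im = t := by rw [hs]; simp
  have hy1 : t / (2 * π * X) < 1 := by linarith
  have hfl : ⌊t / (2 * π * X)⌋₊ = 0 := Nat.floor_eq_zero.2 hy1
  rw [hfl, Finset.Icc_eq_empty_of_lt Nat.zero_lt_one, Finset.sum_empty, mul_zero, sub_zero]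
  have htM : s.im ≤ 2 * π * X * (1 - δ) := by
    rw [him]; rw [div_le_iff₀ (by positivity)] at hy; linarith
  have h := norm_zeta_sub_sum_add_le_uniform_of_gap (s := s) (by rw [hre]; norm_num)
    (by rw [hre]; norm_num) (by rw [him]; exact ht) hX hδ hδ1 htM
  rw [hre, Real.rpow_neg hX0.le, ← Real.sqrt_eq_rpow, ← div_eq_mul_inv] at h
  exact h

/-- **In the stationary range, off resonance** (`y = t/(2πX) ≥ 1`, `δ ≤ {y} ≤ 1 − δ`):
`‖Q_X(s)‖ ≤ (14 + 2/δ + 4 log(y+2))/√X` (Titchmarsh Theorem 4.13 with a gap, tree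
`AFE.approxFunctionalEq_half_of_gap`, plus `‖X^{1−s}/(1−s)‖ ≤ √X/t ≤ 1/√X`). [folklore] -/
theorem norm_Q_le_of_gap {t δ : ℝ} (ht : 0 < t) {X : ℕ} (hX : 1 ≤ X) (hδ : 0 < δ)
    (hy : 1 ≤ t / (2 * π * X)) (hfr1 : δ ≤ Int.fract (t / (2 * π * X)))
    (hfr2 : Int.fract (t / (2 * π * X)) ≤ 1 - δ) (s : ℂ) (hs : s = 1 / 2 + t * I) :
    ‖riemannZeta s - ∑ n ∈ Finset.Icc 1 X, (n : ℂ) ^ (-s) + (X : ℂ) ^ (1 - s) / (1 - s)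
        - afeCoeff s * ∑ n ∈ Finset.Icc 1 ⌊t / (2 * π * X)⌋₊, (n : ℂ) ^ (s - 1)‖ ≤
      (14 + 2 / δ + 4 * Real.log (t / (2 * π * X) + 2)) / Real.sqrt X := by
  have hX0 : (0 : ℝ) < X := by exact_mod_cast hX
  have hty : t = 2 * π * X * (t / (2 * π * X)) := by field_simp
  have hA := approxFunctionalEq_half_of_gap (X := X) (a := X) hX0 hy hδ hty hfr1 hfr2 le_rfl
    (by linarith) hX s hs
  have hmain := norm_cpow_one_sub_div_le ht hX s hs
  -- `√X/t = 1/(2π y √X) ≤ 1/√X`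
  have hsq : Real.sqrt X / t ≤ 1 / Real.sqrt X := by
    rw [div_le_div_iff₀ ht (Real.sqrt_pos.2 hX0), Real.mul_self_sqrt hX0.le, one_mul]
    rw [le_div_iff₀ (by positivity)] at hy
    nlinarith [Real.pi_gt_three]
  have hpow : (X : ℝ) ^ (-(1 / 2 : ℝ)) = 1 / Real.sqrt X := by
    rw [Real.rpow_neg hX0.le, ← Real.sqrt_eq_rpow, one_div]
  rw [hpow] at hA
  have e : riemannZeta s - ∑ n ∈ Finset.Icc 1 X, (n : ℂ) ^ (-s) + (X : ℂ) ^ (1 - s) / (1 - s)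
        - afeCoeff s * ∑ n ∈ Finset.Icc 1 ⌊t / (2 * π * X)⌋₊, (n : ℂ) ^ (s - 1) =
      (riemannZeta s - ∑ n ∈ Finset.Icc 1 X, (n : ℂ) ^ (-s)
        - afeCoeff s * ∑ n ∈ Finset.Icc 1 ⌊t / (2 * π * X)⌋₊, (n : ℂ) ^ (s - 1)) +
      (X : ℂ) ^ (1 - s) / (1 - s) := by ring
  rw [e]
  refine (norm_add_le _ _).trans ?_
  have hlog : 0 ≤ Real.log (t / (2 * π * X) + 2) := Real.log_nonneg (by linarith)
  calc _ ≤ (4 * (1 / Real.sqrt X) + 1 / Real.sqrt X * (2 / δ + 9 + 4 * Real.log (t / (2 * π * X) + 2))) +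
        1 / Real.sqrt X := add_le_add hA (hmain.trans hsq)
    _ = (14 + 2 / δ + 4 * Real.log (t / (2 * π * X) + 2)) / Real.sqrt X := by
        field_simp; ring

end Summit.RiemannHypothesis.RiemannHypothesis.Theorems.EtaLeadingQuarter.Engine

end
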